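import Summits.RiemannHypothesis.RiemannHypothesis.Theorems.WeilParityEvenWinsBeyondArchParityCell91
import Summits.RiemannHypothesis.RiemannHypothesis.Theorems.GroundBartaEvenWinsBeyondArchUpper91Sharp
import Summits.RiemannHypothesis.RiemannHypothesis.Theorems.WeilFormatCDataO94OddRung
import Summits.RiemannHypothesis.RiemannHypothesis.Theorems.GroundBartaEvenWinsBeyondArchUpper94Sharp
import Summits.RiemannHypothesis.RiemannHypothesis.Theorems.WeilFormatCDataO97OddRung
import Summits.RiemannHypothesis.RiemannHypothesis.Theorems.WeilGroundStateGroundStateSimpleEvenCellTransfer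
import Literature.NumberTheory.LFunctions.WeilGroundEnergyParitySplit
import HarnessLib

/-!
# RiemannHypothesis / GroundBarta — the parity ladder: PARITY CELL 11 `(47/50, 9729/10000]` CLOSED — the ladder reaches the window of `7`

Helper file (`--supports stmt-RiemannHypothesis-18085`, `NoParityCrossing`), RH-free.  Prover B (g19 of unit `sr-gb-rung-b`), after
prover A g22's `…ParityCell91` / `…ParityCell94`.

The ladder step on `[47/50, 9729/10000]` (`ε`, `ε_od` antitone; `GroundStateSimpleEven.weilWindowSimpleEven_on_cell_of_le`, the
mechanism of `…LadderStep`'s `weilWindowSimpleEven_upTo_step`, inlined here) from three tree facts: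
* the ladder up to `47/50` (cells 7–10): `weilWindowSimpleEven_upTo_91` (`…ParityCell91`) and the cell-10 step (`trialUpper91sharp`,
  `WeilFormatCData.O94.weilOddGroundEnergy_94_ge_inv_two_pow_75`) re-derived inline — i.e. `weilWindowSimpleEven_upTo_94` of `…ParityCell94`, whose hub olean was pending;
* the U-side at `47/50`: `trialUpper94sharp : ε(47/50) ≤ 2322·10⁻²⁸` (`…Upper94Sharp`, Ritz vector `ne94v1`, killing constant `…MarkovY4` §3);
* the L-side at `9729/10000`: `WeilFormatCData.O97.weilOddGroundEnergy_9729_ge_inv_two_pow_81 : 2⁻⁸¹ ≤ ε_od(9729/10000)`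
  (`WeilFormatCDataO97OddRung`, the format-C ODD λ-run at `a = 9729/10000`, odd block `192`, `μ = 2⁻⁸¹ = 4.14·10⁻²⁵ > 2322·10⁻²⁸`).
`9729/10000 < (log 7)/2 = 0.97295…` is the last window of the four-prime-power regime `{2, 3, 4, 5}` (`WeilFormatCCellShiftBoundA09729`);
the next cell needs the prime `7` in every layer.

* `weilWindowSimpleEven_upTo_9729` — for every `0 < a ≤ 9729/10000` the ground state of the windowed Weil form is simple and even;
* `weilEvenGroundEnergy_lt_weilOddGroundEnergy_upTo_9729`, `tailSimpleEven_upTo_9729` — the strict parity order / the item-18085 tail shape.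

Standard axioms; nothing is defined; no RH claim (a finite-range parity certificate).
-/

set_option linter.dupNamespace false

noncomputable section

open Set MeasureTheory

namespace Summit.RiemannHypothesis.RiemannHypothesis.Theorems.EvenWinsBeyondArch

open Literature.NumberTheory.LFunctions

/-- **Parity cell 11 closed: the ladder reaches `9729/10000`.**  For every window `0 < a ≤ 9729/10000` the windowed Weil form has a simple,
even ground state. [folklore] -/
theorem weilWindowSimpleEven_upTo_9729 : ∀ a : ℝ, 0 < a → a ≤ 9729 / 10000 → WeilWindowSimpleEven a := by
  intro a ha hac
  rcases le_or_gt a (47 / 50) with hab | hba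
  · -- the ladder up to `47/50` (cells 7–10), with the cell-10 step re-derived inline from `…ParityCell91` + `trialUpper91sharp` +
    -- the O94 rung (prover B g19: `…ParityCell94` p431317 is accepted but its hub olean is still pending, so it is not imported)
    rcases le_or_gt a (91 / 100) with hab9 | hba9
    · exact weilWindowSimpleEven_upTo_91 a ha hab9
    · have hU9 := trialUpper91sharp
      have hL10 := WeilFormatCData.O94.weilOddGroundEnergy_94_ge_inv_two_pow_75
      have hUL9 : (2589 / 100000000000000000000000000 : ℝ) < (1 / 2 ^ 75 : ℝ) := by norm_num
      exact GroundStateSimpleEven.weilWindowSimpleEven_on_cell_of_le (b := 91 / 100) (c := 47 / 50) (by norm_num) hUL9 hU9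
        (fun _ hg hs hn ho ↦ hL10.trans (weilOddGroundEnergy_le hg hs ho hn)) hba9.le hab
  · have hU := trialUpper94sharp
    have hL := WeilFormatCData.O97.weilOddGroundEnergy_9729_ge_inv_two_pow_81
    have hUL : (2322 / 10000000000000000000000000000 : ℝ) < (1 / 2 ^ 81 : ℝ) := by norm_num
    exact GroundStateSimpleEven.weilWindowSimpleEven_on_cell_of_le (b := 47 / 50) (c := 9729 / 10000) (by norm_num) hUL hU
      (fun _ hg hs hn ho ↦ hL.trans (weilOddGroundEnergy_le hg hs ho hn)) hba.le hac

/-- The strict parity order `ε_ev(a) < ε_od(a)` for every `0 < a ≤ 9729/10000`. [folklore] -/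
theorem weilEvenGroundEnergy_lt_weilOddGroundEnergy_upTo_9729 {a : ℝ} (ha : 0 < a) (hle : a ≤ 9729 / 10000) :
    weilEvenGroundEnergy a < weilOddGroundEnergy a :=
  (weilWindowSimpleEven_iff_weilEvenGroundEnergy_lt ha).1 (weilWindowSimpleEven_upTo_9729 a ha hle)

/-- Tail shape of item 18085 up to `9729/10000`: simple even ground states on every window `log 2 < a ≤ 9729/10000`. [folklore] -/
theorem tailSimpleEven_upTo_9729 : ∀ a : ℝ, Real.log 2 < a → a ≤ 9729 / 10000 → WeilWindowSimpleEven a :=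
  fun a ha hle ↦ weilWindowSimpleEven_upTo_9729 a ((Real.log_pos (by norm_num)).trans ha) hle

/-- **Item 18085's statement restricted to the certified range**: for every window `(log 3)/2 < a ≤ 9729/10000` the even and odd
sector bottoms do not coincide, `ε_ev(a) ≠ ε_od(a)` — the crux `NoParityCrossing` (`∀ a, (log 3)/2 < a → ε_ev a ≠ ε_od a`) verified on the
finite range of the parity ladder (cells 1–11). [folklore] -/
theorem noParityCrossing_upTo_9729 : ∀ a : ℝ, Real.log 3 / 2 < a → a ≤ 9729 / 10000 →
    weilEvenGroundEnergy a ≠ weilOddGroundEnergy a :=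
  fun a ha hle ↦ (weilEvenGroundEnergy_lt_weilOddGroundEnergy_upTo_9729
    ((div_pos (Real.log_pos (by norm_num)) two_pos).trans ha) hle).ne

end Summit.RiemannHypothesis.RiemannHypothesis.Theorems.EvenWinsBeyondArch

end
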